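/-
Copyright (c) 2026 the pub-hodgecm-mathlib formalisation cell (harness21).  Prover seat hodgecm-mathlib-K2E1-p14 (g2) (DRAFT for the definition seat K2-defs1; R90-TF S8
«U(Φ₃) χ-TWIN», D-S8-3 ED.2 follow-ups named in ★ row 4a `K2E1ChiIntertwinedSectionU3`'s docstring and in K2E1-p16's OPEN-ROWS TABLE (H)), Track B «K2-LIT» ENGINE E1,
h413 = `stmt-HodgeConjecture-24833`, route `HCCMUnconditional`: the `(χ₁, χ₂)`-PAIR section space `V(χ₁, χ₂; K′, ω)` of `U(J₃)` and the pair shape of the reflected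
intertwining, twins of ★ `K2E1ChiSectionSpaceU2Defs.chiSectionSpace` and ★ `K2E1CharacterEisensteinU2Defs.HasReflectedIntertwining`.
-/
import Summits.HodgeConjecture.HodgeConjecture.Theorems.K2E1CharacterEisensteinU3PairDefs   -- ★ p861816 (D-S8-3): `IsChiSectionPair`, `middleEntryUnitary`, `isChiSectionPair_iff_isChiSection_of_trivial`
import Summits.HodgeConjecture.HodgeConjecture.Theorems.K2E1ChiSectionSpaceU2Defs            -- ★ `chiSectionSpace χ K′ ω` (every rank; the `χ₂ = 1` sub-family)
import HarnessLib

/-!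
# D-S8-3 ED.2 (DRAFT) — `K2E1ChiSectionSpaceU3PairDefs`: THE `(χ₁, χ₂)`-PAIR SECTION SPACE `V(χ₁, χ₂; K′, ω)` OF `U(J₃)` AND THE PAIR SHAPE `HasReflectedIntertwiningPair`
# OF THE REFLECTED INTERTWINING (`z ↦ 2 − z`, `(χ₁, χ₂) ↦ (χ₁ʷ, χ₂)`)

Track B ∕ K2-LIT, crux h413 = `stmt-HodgeConjecture-24833`, route of record `HCCMUnconditional`; cell `hodgecm-mathlib`, R90-TF slab S8 (TWIN-DAG (H): the N = 3 `CharM` pair-indexed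
packaging debt).  DEFINITIONS FILE (`--kind definition`, review-queued; to be proposed by the definition seat K2-defs1; drafted by K2E1-p14 (g2)): TWO `def`s + read-backs; no
`instance`, no `notation`, no named-fact hypothesis, no `sorry`; default heartbeats.  Generic quadratic datum `(F, E, c)`; rank `3`.

THE MATHEMATICS ([MoeglinWaldspurger1995, I.2.17, II.1.7]; [Rogawski1990, §13.9 p. 229 («`χ = (φ, ψ)` a unitary character of `M\𝐌`»)]).  On `U(J₃)`, `B = TN`, `T(𝔸) ∋ d(α, β, ᾱ⁻¹)`;
a `(χ₁, χ₂)`-pair-section is `φ(b g) = χ₁(b₀₀) χ₂(b₁₁) φ(g)` (★ `IsChiSectionPair`).  §1 packages, exactly as ★ `chiSectionSpace` does for one character, the `ℂ`-submodule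
`V(χ₁, χ₂; K′, ω) := {φ | IsChiSectionPair χ₁ χ₂ φ ∧ ∀ g k, φ(g k) = ω(k) φ(g)}` (right `(K′, ω)`-law; the consumer chooses `K′`, `ω`), with the membership API and the read-back
`V(χ₁, 1; K′, ω) = V(χ₁, K′, ω)` (★ `isChiSectionPair_iff_isChiSection_of_trivial`) — so every ★ statement over `chiSectionSpace χ K′ ω` at N = 3 (rows 7b-1∕7b-2, (C) FILE 2 §2) is
the `χ₂ = 1` instance of a pair statement.  §2 is the PAIR SHAPE of the reflected intertwining (twin of ★ `HasReflectedIntertwining`, N = 2, `1 − z`): `φ′` is a `(χ₁ʷ, χ₂)`-pair-section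
(`χ₁ʷ = reflectChar c χ₁`, middle character unchanged) AND `∫_N f_z^φ(W v g) dν = f_{2−z}^{φ′}(g)` for every `g` — inhabited by ★ row 4a
`⟨isChiSectionPair_intertwinedCoeff_three …, flatSectionU_intertwinedCoeff_three_eq …⟩` with `φ′ := (M(w₀) f_z)·H^{z−2}` (not restated here: this leaf imports no analysis).
* §1 `chiSectionSpacePair χ₁ χ₂ K′ ω` + `mem_chiSectionSpacePair_iff`, `isChiSectionPair_of_mem`, `apply_mul_of_mem`, `apply_borel_mul_mul_of_mem`,
  `chiSectionSpacePair_eq_chiSectionSpace_of_trivial`, `chiSectionSpacePair_one`.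
* §2 `HasReflectedIntertwiningPair χ₁ χ₂ νN φ φ′ z` + `.isChiSectionPair`, `.integral_eq`.
HONEST LABEL: HC_CM is proved only modulo the 7 printed citations (2 remaining named inputs: hLiu418 = `stmt-HodgeConjecture-24832`, h413 = `stmt-HodgeConjecture-24833`) until rung 0
closes; definitions + read-backs only, closes no socket; count-neutral.

## References
* [MoeglinWaldspurger1995] C. Mœglin, J.-L. Waldspurger, *Spectral decomposition and Eisenstein series* (1995), I.2.17 (induced spaces, sections), II.1.7 (the reflected section).
* [Rogawski1990] J. D. Rogawski, *Automorphic Representations of Unitary Groups in Three Variables* (1990), §13.9 p. 229.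
-/

set_option autoImplicit false
-- the mandated namespace repeats the single-problem summit's segment (`HodgeConjecture.HodgeConjecture`)
set_option linter.dupNamespace false

noncomputable section

open NumberField IsDedekindDomain MeasureTheory
open scoped MatrixGroups
open Literature.NumberTheory.Automorphic Literature.NumberTheory.Automorphic.UnitaryGroup AdelicGroupData
open Literature.NumberTheory.Automorphic.Arthur2013.Leaves.TECR
open Literature.NumberTheory.GaloisRepresentations (HeckeCharacter)
open Summit.HodgeConjecture.HodgeConjecture.Cruxes.H413.K2E1BorelEisensteinU
open Summit.HodgeConjecture.HodgeConjecture.Cruxes.H413.K2E1CharacterEisensteinU2Defs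
open Summit.HodgeConjecture.HodgeConjecture.Cruxes.H413.K2E1CharacterEisensteinU3PairDefs
open Summit.HodgeConjecture.HodgeConjecture.Cruxes.H413.K2E1ChiSectionSpaceU2Defs (chiSectionSpace mem_chiSectionSpace_iff)

namespace Summit.HodgeConjecture.HodgeConjecture.Cruxes.H413.K2E1ChiSectionSpaceU3PairDefs

variable {F E : Type} [Field F] [NumberField F] [Field E] [NumberField E] [Algebra F E] {c : E ≃ₐ[F] E}

/-! ## §1 The pair section space `V(χ₁, χ₂; K′, ω)` -/

/-- **THE `(χ₁, χ₂)`-PAIR SECTION SPACE `V(χ₁, χ₂; K′, ω)` OF `U(J₃)`**: the functions `φ : G(𝔸_F) → ℂ` that are `(χ₁, χ₂)`-pair-sections (`φ(b g) = χ₁(b₀₀) χ₂(b₁₁) φ(g)`,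
`b ∈ B(𝔸_F)`, ★ `IsChiSectionPair`) and transform on the right under the subgroup `K′` by the function `ω` (`φ(g k) = ω(k) φ(g)`), as a `ℂ`-submodule of `G(𝔸_F) → ℂ` — the pair
twin of ★ `chiSectionSpace` (`χ₂ = 1` recovers it, `chiSectionSpacePair_one`). [cite: MoeglinWaldspurger1995, I.2.17] [cite: Rogawski1990, §13.9 p. 229] -/
def chiSectionSpacePair (χ₁ : HeckeCharacter E) (χ₂ : ↥(TorusDict.torus c) →ₜ* ℂˣ) (K' : Subgroup (quasiSplit F E c 3).Adelic) (ω : ↥K' → ℂ) : Submodule ℂ ((quasiSplit F E c 3).Adelic → ℂ) where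
  carrier := {φ | IsChiSectionPair χ₁ χ₂ φ ∧ ∀ (g : (quasiSplit F E c 3).Adelic) (k : ↥K'), φ (g * (k : (quasiSplit F E c 3).Adelic)) = ω k * φ g}
  zero_mem' := ⟨IsChiSectionPair.zero χ₁ χ₂, fun g k => by simp⟩
  add_mem' := by
    rintro φ ψ ⟨hφ, hφ'⟩ ⟨hψ, hψ'⟩
    exact ⟨hφ.add hψ, fun g k => by simp only [Pi.add_apply, hφ' g k, hψ' g k, mul_add]⟩
  smul_mem' := by
    rintro a φ ⟨hφ, hφ'⟩
    exact ⟨hφ.smul a, fun g k => by simp only [Pi.smul_apply, smul_eq_mul, hφ' g k]; ring⟩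

variable {χ₁ : HeckeCharacter E} {χ₂ : ↥(TorusDict.torus c) →ₜ* ℂˣ} {K' : Subgroup (quasiSplit F E c 3).Adelic} {ω : ↥K' → ℂ}

/-- Membership in `V(χ₁, χ₂; K′, ω)`. [cite: MoeglinWaldspurger1995, I.2.17] -/
theorem mem_chiSectionSpacePair_iff (φ : (quasiSplit F E c 3).Adelic → ℂ) :
    φ ∈ chiSectionSpacePair χ₁ χ₂ K' ω ↔ IsChiSectionPair χ₁ χ₂ φ ∧ ∀ (g : (quasiSplit F E c 3).Adelic) (k : ↥K'), φ (g * (k : (quasiSplit F E c 3).Adelic)) = ω k * φ g := Iff.rfl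

/-- Elements of `V(χ₁, χ₂; K′, ω)` are `(χ₁, χ₂)`-pair-sections. [cite: MoeglinWaldspurger1995, I.2.17] -/
theorem isChiSectionPair_of_mem {φ : (quasiSplit F E c 3).Adelic → ℂ} (hφ : φ ∈ chiSectionSpacePair χ₁ χ₂ K' ω) : IsChiSectionPair χ₁ χ₂ φ := hφ.1

/-- Elements of `V(χ₁, χ₂; K′, ω)` transform by `ω` on the right. [cite: MoeglinWaldspurger1995, I.2.17] -/
theorem apply_mul_of_mem {φ : (quasiSplit F E c 3).Adelic → ℂ} (hφ : φ ∈ chiSectionSpacePair χ₁ χ₂ K' ω) (g : (quasiSplit F E c 3).Adelic) (k : ↥K') :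
    φ (g * (k : (quasiSplit F E c 3).Adelic)) = ω k * φ g := hφ.2 g k

/-- Both laws give membership. [cite: MoeglinWaldspurger1995, I.2.17] -/
theorem mem_chiSectionSpacePair {φ : (quasiSplit F E c 3).Adelic → ℂ} (hφ : IsChiSectionPair χ₁ χ₂ φ) (hφK : ∀ (g : (quasiSplit F E c 3).Adelic) (k : ↥K'), φ (g * (k : (quasiSplit F E c 3).Adelic)) = ω k * φ g) :
    φ ∈ chiSectionSpacePair χ₁ χ₂ K' ω := ⟨hφ, hφK⟩

/-- **The two-sided rule**: `φ(b s k) = χ₁(b₀₀)·χ₂(b₁₁)·ω(k)·φ(s)`. [cite: MoeglinWaldspurger1995, I.2.17] -/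
theorem apply_borel_mul_mul_of_mem {φ : (quasiSplit F E c 3).Adelic → ℂ} (hφ : φ ∈ chiSectionSpacePair χ₁ χ₂ K' ω)
    {b : (quasiSplit F E c 3).Adelic} (hb : b ∈ borelAdelic F E c 3) (s : (quasiSplit F E c 3).Adelic) (k : ↥K') :
    φ (b * s * (k : (quasiSplit F E c 3).Adelic)) = ((χ₁ (firstEntryUnit hb) : ℂˣ) : ℂ) * ((χ₂ (middleEntryUnitary hb) : ℂˣ) : ℂ) * ω k * φ s := by
  rw [mul_assoc, hφ.1 b hb, hφ.2 s k]
  ring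

/-- **READ-BACK: for `χ₂` trivial on `T(𝔸_F)` the pair space IS the ★ single-character space** `V(χ₁, K′, ω) = chiSectionSpace χ₁ K′ ω` (★ `isChiSectionPair_iff_isChiSection_of_trivial`).
[cite: MoeglinWaldspurger1995, I.2.17] -/
theorem chiSectionSpacePair_eq_chiSectionSpace_of_trivial (hχ₂ : ∀ t : ↥(TorusDict.torus c), χ₂ t = 1) :
    chiSectionSpacePair χ₁ χ₂ K' ω = chiSectionSpace χ₁ K' ω := by
  ext φ
  rw [mem_chiSectionSpacePair_iff, mem_chiSectionSpace_iff, isChiSectionPair_iff_isChiSection_of_trivial hχ₂]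

/-- **READ-BACK at the trivial torus character `1`**: `V(χ₁, 1; K′, ω) = V(χ₁, K′, ω)`. [cite: MoeglinWaldspurger1995, I.2.17] -/
theorem chiSectionSpacePair_one (χ₁ : HeckeCharacter E) (K' : Subgroup (quasiSplit F E c 3).Adelic) (ω : ↥K' → ℂ) :
    chiSectionSpacePair χ₁ (1 : ↥(TorusDict.torus c) →ₜ* ℂˣ) K' ω = chiSectionSpace χ₁ K' ω :=
  chiSectionSpacePair_eq_chiSectionSpace_of_trivial fun t => by rw [ContinuousMonoidHom.coe_one, Pi.one_apply]

/-! ## §2 The pair shape of the reflected intertwining (`z ↦ 2 − z`, `(χ₁, χ₂) ↦ (χ₁ʷ, χ₂)`) -/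

/-- **`HasReflectedIntertwiningPair χ₁ χ₂ νN φ φ′ z`** (the N = 3 twin of ★ `HasReflectedIntertwining`, statement shape only): `φ′` is a `(χ₁ʷ, χ₂)`-pair-section
(`χ₁ʷ = reflectChar c χ₁`; the MIDDLE character is unchanged by the long Weyl element) and the big-cell intertwining integral of `f_z^φ` is the flat section of `φ′` at the
REFLECTED parameter `2 − z` (`2ρ_B = 2` on `U(J₃)`): `∫_{N(𝔸)} f_z^φ(W v g) dν_N(v) = f_{2−z}^{φ′}(g)` for every `g`.  Inhabited (every `z`, no convergence hypothesis) by ★ row 4a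
`K2E1ChiIntertwinedSectionU3.isChiSectionPair_intertwinedCoeff_three` + `flatSectionU_intertwinedCoeff_three_eq` with `φ′ := (M(w₀) f_z)·H^{z−2}`. [cite: MoeglinWaldspurger1995, II.1.7] -/
def HasReflectedIntertwiningPair [MeasurableSpace (quasiSplit F E c 3).Adelic] (χ₁ : HeckeCharacter E) (χ₂ : ↥(TorusDict.torus c) →ₜ* ℂˣ) (νN : Measure ↥(adelicUnipotent F E c 3))
    (φ φ' : (quasiSplit F E c 3).Adelic → ℂ) (z : ℂ) : Prop :=
  IsChiSectionPair (reflectChar c χ₁) χ₂ φ' ∧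
    ∀ g : (quasiSplit F E c 3).Adelic,
      ∫ v : ↥(adelicUnipotent F E c 3), flatSectionU φ z ((quasiSplit F E c 3).toAdelic (weylLongU (c : E →+* E) (rfl : (StdForm.antidiagonal 3).over E = (StdForm.antidiagonal 3).over E)) *
        (v : (quasiSplit F E c 3).Adelic) * g) ∂νN = flatSectionU φ' (2 - z) g

/-- Unfolding `HasReflectedIntertwiningPair`: the reflected pair-section. [cite: MoeglinWaldspurger1995, II.1.7] -/
theorem HasReflectedIntertwiningPair.isChiSectionPair [MeasurableSpace (quasiSplit F E c 3).Adelic] {νN : Measure ↥(adelicUnipotent F E c 3)}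
    {φ φ' : (quasiSplit F E c 3).Adelic → ℂ} {z : ℂ} (h : HasReflectedIntertwiningPair χ₁ χ₂ νN φ φ' z) : IsChiSectionPair (reflectChar c χ₁) χ₂ φ' := h.1

/-- Unfolding `HasReflectedIntertwiningPair`: the big-cell integral at the reflected parameter `2 − z`. [cite: MoeglinWaldspurger1995, II.1.7] -/
theorem HasReflectedIntertwiningPair.integral_eq [MeasurableSpace (quasiSplit F E c 3).Adelic] {νN : Measure ↥(adelicUnipotent F E c 3)}
    {φ φ' : (quasiSplit F E c 3).Adelic → ℂ} {z : ℂ} (h : HasReflectedIntertwiningPair χ₁ χ₂ νN φ φ' z) (g : (quasiSplit F E c 3).Adelic) :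
    ∫ v : ↥(adelicUnipotent F E c 3), flatSectionU φ z ((quasiSplit F E c 3).toAdelic (weylLongU (c : E →+* E) (rfl : (StdForm.antidiagonal 3).over E = (StdForm.antidiagonal 3).over E)) *
        (v : (quasiSplit F E c 3).Adelic) * g) ∂νN = flatSectionU φ' (2 - z) g := h.2 g

end Summit.HodgeConjecture.HodgeConjecture.Cruxes.H413.K2E1ChiSectionSpaceU3PairDefs

end
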